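import Literature.AlgebraicGeometry.Motives.ProjectiveNoetherNormalization
import Literature.AlgebraicGeometry.Motives.FiniteFlatSandwich
import Literature.AlgebraicGeometry.Motives.AmpleAsymptotics
import Mathlib.Data.Nat.Prime.Infinite
import HarnessLib

/-!
# Proof of the asymptotic Riemann–Roch theorem for ample divisors (Görtz–Wedhorn II, Prop. 23.83)

The named fact `CartierDivisor.asymptoticRiemannRoch_of_isAmple` (`Motives/AbelianVarietyDegree`;
Görtz–Wedhorn II, Prop. 23.83 with Rem. 23.82: for an ample Cartier divisor `D` on an integral proper
`K`-scheme `X` of dimension `d` there is an integer `δ > 0` with `h⁰(nD) = δ n^d/d! + O(n^{d-1})`) is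
printed with a two-line proof through coherent cohomology (asymptotic Riemann–Roch for `χ` via
`K`-theory, Prop. 23.78, plus Serre vanishing, Thm. 23.2), none of which Mathlib has. This file
**proves** it (`asymptoticRiemannRoch_of_isAmple_holds`) by the cohomology-free comparison with
projective space assembled in this directory:

1. *Normalisation* (`Motives/ProjectiveNoetherNormalization`): for two coprime integers
   `M = n₀ pᶜ`, `M' = (n₀ + 1) p'^{c'}` there are finite surjective `K`-morphisms `ψ : X → ℙ^d_K`,
   `d = dim X`, with `ψ^*H ∼ M • D` (forms of `p`-power degree without common zero on the sections
   of the eventually generated `n₀ • D`, Görtz–Wedhorn I, Prop. 13.47).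
2. *Sandwich* (`Motives/FiniteFlatSandwich`, by a sibling file of this directory): for `ψ` finite of
   generic degree `r = [K(X) : K(ℙ^d)]`,
   `r h⁰(ℙ^d, 𝒪(m)) ≤ h⁰(X, (m+a) ψ^*H)` and `h⁰(X, m ψ^*H) ≤ r h⁰(ℙ^d, 𝒪(m+a))`.
3. *Sections of `ℙ^d`* (`Motives/ProjectiveSpaceSections`): `h⁰(ℙ^d, 𝒪(m)) = C(m + d, d)`.
4. *Asymptotics* (`Motives/AmpleAsymptotics`): hence `h⁰((Mk) D) = r k^d/d! + O(k^{d-1})`, and, the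
   `h⁰(nD)` being non-decreasing under shifts by degrees carrying nonzero sections
   (`Motives/CartierDivisorAmple`), `h⁰(nD) = (r/M^d) n^d/d! + O(n^{d-1})` along all `n`; comparing the
   two normalisations, `δ := r/M^d = r'/M'^d` with `δ M^d, δ M'^d ∈ ℕ` and `gcd(M^d, M'^d) = 1`, so
   `δ ∈ ℕ` (Bézout), and `δ > 0` as `r ≥ 1`.

The integer `δ` is the degree `(𝒪_X(D)^d)` of Def. 23.80 (not available as such); the statement
proved is literally the named fact.

## References

* U. Görtz, T. Wedhorn, *Algebraic Geometry II: Cohomology of Schemes*, Springer Spektrum (2023),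
  doi:10.1007/978-3-658-43031-3: Prop. 23.83 and Rem. 23.82, Def. 23.80, p. 447 (read via the held
  copy, PDF p. 447); Prop. 23.84 and Def. 23.76 (pp. 445–447). [GortzWedhorn2023]
* U. Görtz, T. Wedhorn, *Algebraic Geometry I: Schemes*, 2nd ed. (2020): Prop. 13.47, Thm. 13.89.
  [GortzWedhorn2020]
-/

universe u

open CategoryTheory AlgebraicGeometry Limits TopologicalSpace Opposite Asymptotics Filter
open Literature.AlgebraicGeometry.Motives.Segre Literature.AlgebraicGeometry.Motives.RatFn

noncomputable section

namespace Literature.AlgebraicGeometry.Motives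

namespace CartierDivisor

/-! ### The canonical section `1` of the hyperplane divisor -/

section Hyperplane

variable {d : ℕ} {K : Type u} [Field K]

/-- `1` is a section of `𝒪(H)` on `ℙ^d` (the generating section `x₀` itself). [folklore] -/
theorem isSection_one_hyperplane : ((1 : ℕ) • ProjSpace.hyperplane d K).IsSection 1 := by
  rw [CartierDivisor.one_smul]
  have h := (ProjSpace.gens (d := d) (K := K)).isSection_divisor_ratioFn 0
    (ProjSpace.genericPoint_mem_U 0) 0
  rwa [GeneratingSections.ratioFn_self] at h

/-- The non-vanishing locus of the section `1` of `𝒪(H)` is the chart `D₊(x₀)`. [folklore] -/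
theorem nonvanishing_one_hyperplane :
    ((1 : ℕ) • ProjSpace.hyperplane d K).nonvanishing 1 = (ProjSpace.U (d := d) (K := K) 0 : Set _) := by
  rw [CartierDivisor.one_smul]
  have h := (ProjSpace.gens (d := d) (K := K)).nonvanishing_divisor_ratioFn 0
    (ProjSpace.genericPoint_mem_U 0) 0
  rwa [GeneratingSections.ratioFn_self] at h

/-- The generic point of `ℙ^d` lies in the non-vanishing locus of the section `1` of `𝒪(H)`.
[folklore] -/
theorem genericPoint_mem_nonvanishing_one_hyperplane :
    genericPoint (ProjSpace.P d K) ∈ ((1 : ℕ) • ProjSpace.hyperplane d K).nonvanishing 1 := by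
  rw [nonvanishing_one_hyperplane]; exact ProjSpace.genericPoint_mem_U 0

/-- The non-vanishing locus of the section `1` of `𝒪(H)` is affine. [folklore] -/
theorem isAffineOpen_nonvanishingOpens_one_hyperplane :
    IsAffineOpen (((1 : ℕ) • ProjSpace.hyperplane d K).nonvanishingOpens 1) := by
  have : ((1 : ℕ) • ProjSpace.hyperplane d K).nonvanishingOpens 1 = ProjSpace.U 0 :=
    Opens.ext nonvanishing_one_hyperplane
  rw [this]
  exact GeneratingSections.isAffineOpen_ofHom_U (𝟙 (ProjSpace.P d K)) 0

end Hyperplane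

/-! ### Asymptotics of `h⁰(m ψ^*H)` for a finite `ψ : X → ℙ^d` -/

section Finite

variable {K : Type u} [Field K] {X : Scheme.{u}} [IsIntegral X] [X.Over (Spec (.of K))] {d : ℕ}
  (ψ : X ⟶ ProjSpace.P d K) [IsFinite ψ] [Surjective ψ] [ψ.IsOver (Spec (.of K))]

/-- For a finite surjective `K`-morphism `ψ : X → ℙ^d` the spaces `Γ(X, 𝒪(m ψ^*H))` are
finite-dimensional: they embed into `Γ(ℙ^d, 𝒪((m+a)H))^r`
(`CartierDivisor.eventually_exists_linearMap_sections_pi`). [folklore] -/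
theorem finiteDimensional_sections_pullback_hyperplane (m : ℕ) :
    FiniteDimensional K ((m • (ProjSpace.hyperplane d K).pullback ψ).sections K) := by
  obtain ⟨e, -⟩ := FunctionFieldOver.exists_basis_mem_range ψ
    isAffineOpen_nonvanishingOpens_one_hyperplane genericPoint_mem_nonvanishing_one_hyperplane
  obtain ⟨c, hc0, hc⟩ := FunctionFieldOver.exists_denominator ψ
    isAffineOpen_nonvanishingOpens_one_hyperplane genericPoint_mem_nonvanishing_one_hyperplane e
  have hev := (ProjSpace.hyperplane d K).eventually_exists_linearMap_sections_pi ψ K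
    isSection_one_hyperplane genericPoint_mem_nonvanishing_one_hyperplane
    isAffineOpen_nonvanishingOpens_one_hyperplane e hc hc0
  obtain ⟨P, hP⟩ := hev.exists
  obtain ⟨Ψ, hΨ⟩ := hP m
  exact Module.Finite.of_injective Ψ hΨ

/-- **`h⁰(X, m ψ^*H) = r m^d/d! + O(m^{d-1})`** for a finite surjective `K`-morphism `ψ : X → ℙ^d`,
`r = [K(X) : K(ℙ^d)]`: the sandwich `r C(m - a + d, d) ≤ h⁰(m ψ^*H) ≤ r C(m + a + d, d)`
(`CartierDivisor.exists_sandwich_h0` with `h⁰(ℙ^d, 𝒪(m)) = C(m + d, d)`). [folklore] -/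
theorem hasAsympDegree_pullback_hyperplane :
    ((ProjSpace.hyperplane d K).pullback ψ).HasAsympDegree K d
      (Module.finrank (ProjSpace.P d K).functionField (FunctionFieldOver ψ)) := by
  set r := Module.finrank (ProjSpace.P d K).functionField (FunctionFieldOver ψ) with hr
  set E := (ProjSpace.hyperplane d K).pullback ψ with hE
  obtain ⟨a, ha⟩ := (ProjSpace.hyperplane d K).exists_sandwich_h0 ψ K isSection_one_hyperplane
    genericPoint_mem_nonvanishing_one_hyperplane isAffineOpen_nonvanishingOpens_one_hyperplane
  haveI := finiteDimensional_sections_pullback_hyperplane ψ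
  refine isBigO_sub_of_choose_sandwich (a := a) (s := d) (b := a + d) ?_ ?_
  · filter_upwards [Filter.eventually_ge_atTop a] with n hn
    have h1 := (ha (n - a)).1 (finiteDimensional_sections_pullback_hyperplane ψ _)
    rw [Nat.sub_add_cancel hn, ProjSpace.h0_hyperplane] at h1
    exact_mod_cast h1
  · filter_upwards with n
    have h2 := (ha n).2 inferInstance
    rw [ProjSpace.h0_hyperplane, show n + a + d = n + (a + d) by ring] at h2
    exact_mod_cast h2

omit [X.Over (Spec (.of K))] [ψ.IsOver (Spec (.of K))] in
/-- The generic degree `r = [K(X) : K(ℙ^d)]` of a finite surjective morphism is positive. [folklore] -/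
theorem finrank_functionFieldOver_pos :
    0 < Module.finrank (ProjSpace.P d K).functionField (FunctionFieldOver ψ) :=
  Module.finrank_pos

end Finite

/-! ### From `ψ^*H ∼ M • D` to the asymptotics of `h⁰(nD)` along all `n` -/

section Transfer

variable {K : Type u} [Field K] {X : Scheme.{u}} [IsIntegral X] [X.Over (Spec (.of K))]
  {D : CartierDivisor X}

/-- If `𝒪(t D)` has a nonzero section for all `t ≥ n₁` and the spaces `Γ(X, 𝒪((Mj) D))` are
finite-dimensional for all `j` (`M ≥ 1`), then all `Γ(X, 𝒪(k D))` are finite-dimensional (embed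
`Γ(kD) ↪ Γ((k+t)D)` with `k + t` a multiple of `M`). [folklore] -/
theorem finiteDimensional_sections_of_multiples {n₁ M : ℕ} (hM : 0 < M)
    (hsec : ∀ t, n₁ ≤ t → ∃ s : X.functionField, (t • D).IsSection s ∧ s ≠ 0)
    (hfin : ∀ j, FiniteDimensional K (((M * j) • D).sections K)) (k : ℕ) :
    FiniteDimensional K ((k • D).sections K) := by
  -- `t = M (n₁ + k) - k ≥ n₁` and `k + t = M (n₁ + k)`
  have hle : k ≤ M * (n₁ + k) := by nlinarith
  obtain ⟨s, hs, hs0⟩ := hsec (M * (n₁ + k) - k) (by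
    have : n₁ + k ≤ M * (n₁ + k) := Nat.le_mul_of_pos_left _ hM
    omega)
  have e : k + (M * (n₁ + k) - k) = M * (n₁ + k) := by omega
  haveI : FiniteDimensional K (((k + (M * (n₁ + k) - k)) • D).sections K) := by
    rw [e]; exact hfin _
  exact finiteDimensional_of_isSection K hs hs0

/-- **Transfer.** If `E ∼ M • D` (`M ≥ 1`), `h⁰(k E) = r k^d/d! + O(k^{d-1})`, the `Γ(X, 𝒪(k E))` are
finite-dimensional and `𝒪(tD)` has nonzero sections for all `t ≥ n₁`, then
`h⁰(nD) = (r/M^d) n^d/d! + O(n^{d-1})` along all `n` (`AmpleAsymptotics.isBigO_sub_of_isBigO_comp_mul`).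
[folklore] -/
theorem isBigO_h0_of_linEquiv_smul {E : CartierDivisor X} {M r d n₁ : ℕ} (hM : 0 < M)
    (hE : E.LinEquiv (M • D)) (hasymp : E.HasAsympDegree K d r)
    (hfinE : ∀ k : ℕ, FiniteDimensional K ((k • E).sections K))
    (hsec : ∀ t, n₁ ≤ t → ∃ s : X.functionField, (t • D).IsSection s ∧ s ≠ 0) :
    (fun n : ℕ => ((n • D).h0 K : ℝ) - (r : ℝ) / (M : ℝ) ^ d * (n : ℝ) ^ d / d.factorial) =O[atTop]
      fun n : ℕ => (n : ℝ) ^ ((d : ℤ) - 1) := by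
  -- `h⁰(k E) = h⁰((M k) D)` and finite-dimensionality along the multiples
  have hh0 : ∀ k, (k • E).h0 K = ((M * k) • D).h0 K := fun k => by
    rw [(hE.smul k).h0_eq K, CartierDivisor.smul_smul]
  have hfin : ∀ j, FiniteDimensional K (((M * j) • D).sections K) := fun j => by
    obtain ⟨h, hh, H⟩ := (linEquiv_iff _ _).1 (hE.smul j)
    haveI := hfinE j
    have e := sectionsEquivOfLinEquiv K hh H
    rw [CartierDivisor.smul_smul] at e
    exact LinearEquiv.finiteDimensional e
  have hfinall : ∀ k : ℕ, FiniteDimensional K ((k • D).sections K) :=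
    finiteDimensional_sections_of_multiples hM hsec hfin
  refine isBigO_sub_of_isBigO_comp_mul (u := fun n => ((n • D).h0 K : ℝ)) (n₁ := n₁) hM
    (fun n hn m => ?_) ?_
  · obtain ⟨s, hs, hs0⟩ := hsec n hn
    haveI := hfinall (m + n)
    exact_mod_cast h0_le_h0_add_of_isSection K hs hs0
  · refine hasymp.congr_left fun k => ?_
    simp only [hh0 k]

end Transfer

/-! ### The theorem -/

/-- Coprimality of the two comparison degrees `n p^c` and `(n+1) p'^{c'}` for primes
`p' > p > n + 1`. [folklore] -/
theorem coprime_mul_pow_succ_mul_pow {n p p' c c' : ℕ} (hn : 0 < n) (hp : p.Prime) (hp' : p'.Prime)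
    (hnp : n + 1 < p) (hpp' : p < p') : Nat.Coprime (n * p ^ c) ((n + 1) * p' ^ c') := by
  have h1 : Nat.Coprime n (n + 1) := Nat.coprime_self_add_right.2 (Nat.coprime_one_right n)
  have h2 : Nat.Coprime n (p' ^ c') := by
    refine Nat.Coprime.pow_right _ ((Nat.coprime_comm).1 ((Nat.Prime.coprime_iff_not_dvd hp').2 ?_))
    exact Nat.not_dvd_of_pos_of_lt hn (by omega)
  have h3 : Nat.Coprime (p ^ c) (n + 1) := by
    refine Nat.Coprime.pow_left _ ((Nat.Prime.coprime_iff_not_dvd hp).2 ?_)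
    exact Nat.not_dvd_of_pos_of_lt (Nat.succ_pos n) hnp
  have h4 : Nat.Coprime (p ^ c) (p' ^ c') :=
    Nat.Coprime.pow _ _ ((Nat.coprime_primes hp hp').2 (Nat.ne_of_lt hpp'))
  exact Nat.Coprime.mul_left (Nat.Coprime.mul_right h1 h2) (Nat.Coprime.mul_right h3 h4)

/-- **Görtz–Wedhorn II, Prop. 23.83 with Rem. 23.82 (asymptotic Riemann–Roch for an ample divisor),
proved**: for an ample Cartier divisor `D` on an integral proper `K`-scheme `X` there is an integer
`δ > 0` with `h⁰(nD) = δ n^{dim X}/(dim X)! + O(n^{dim X - 1})`. Discharges the named fact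
`CartierDivisor.asymptoticRiemannRoch_of_isAmple` by the comparison with `ℙ^{dim X}` described in the
module docstring (no coherent cohomology). [cite: GortzWedhorn2023, Prop. 23.83 and Rem. 23.82 (p. 447)] -/
theorem asymptoticRiemannRoch_of_isAmple_holds : asymptoticRiemannRoch_of_isAmple.{u} := by
  intro K _ X _ _ _ D hD
  classical
  set d := schemeDim X with hd
  -- nonzero sections in all large degrees
  obtain ⟨n₁, hn₁⟩ := hD.exists_forall_le_isSection_ne_zero
  -- two normalisations with coprime degrees
  obtain ⟨n₀, hn₀⟩ := hD.exists_finite_surjective_linEquiv (K := K)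
  set n := n₀ + 1 with hn
  obtain ⟨p, hp1, hp⟩ := Nat.exists_infinite_primes (n + 2)
  obtain ⟨p', hp'1, hp'⟩ := Nat.exists_infinite_primes (p + 1)
  obtain ⟨c, ψ, hψfin, hψsurj, hψover, hψE⟩ := hn₀ p hp.one_lt n (Nat.le_succ _) (Nat.succ_pos _)
  obtain ⟨c', ψ', hψ'fin, hψ'surj, hψ'over, hψ'E⟩ :=
    hn₀ p' hp'.one_lt (n + 1) (by omega) (Nat.succ_pos _)
  haveI : ψ.IsOver (Spec (.of K)) := ⟨hψover⟩
  haveI : ψ'.IsOver (Spec (.of K)) := ⟨hψ'over⟩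
  set M := n * p ^ c with hM
  set M' := (n + 1) * p' ^ c' with hM'
  have hM0 : 0 < M := Nat.mul_pos (Nat.succ_pos _) (Nat.pow_pos hp.pos)
  have hM'0 : 0 < M' := Nat.mul_pos (Nat.succ_pos _) (Nat.pow_pos hp'.pos)
  set r := Module.finrank (ProjSpace.P d K).functionField (FunctionFieldOver ψ) with hr
  set r' := Module.finrank (ProjSpace.P d K).functionField (FunctionFieldOver ψ') with hr'
  have hr0 : 0 < r := finrank_functionFieldOver_pos ψ
  -- the two asymptotic expansions of `h⁰(nD)`
  have h₁ := isBigO_h0_of_linEquiv_smul (K := K) hM0 hψE (hasAsympDegree_pullback_hyperplane ψ)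
    (finiteDimensional_sections_pullback_hyperplane ψ) hn₁
  have h₂ := isBigO_h0_of_linEquiv_smul (K := K) hM'0 hψ'E (hasAsympDegree_pullback_hyperplane ψ')
    (finiteDimensional_sections_pullback_hyperplane ψ') hn₁
  -- the leading coefficients agree
  set δ : ℝ := (r : ℝ) / (M : ℝ) ^ d with hδ
  have hMR : (0 : ℝ) < M := by exact_mod_cast hM0
  have hM'R : (0 : ℝ) < M' := by exact_mod_cast hM'0
  have hδ' : (r' : ℝ) / (M' : ℝ) ^ d = δ := by
    refine eq_of_sub_mul_pow_div_isBigO (d := d) ((h₁.sub h₂).congr_left fun k => ?_)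
    ring
  -- `δ M^d = r` and `δ M'^d = r'` are naturals, `M^d` and `M'^d` coprime: `δ ∈ ℕ`
  have hcop : Nat.Coprime (M ^ d) (M' ^ d) :=
    Nat.Coprime.pow _ _ (coprime_mul_pow_succ_mul_pow (Nat.succ_pos _) hp hp' (by omega) (by omega))
  have hδM : δ * ((M ^ d : ℕ) : ℝ) = (r : ℕ) := by
    rw [hδ]; push_cast; field_simp
  have hδM' : δ * ((M' ^ d : ℕ) : ℝ) = (r' : ℕ) := by
    rw [← hδ']; push_cast; field_simp
  have hδnn : 0 ≤ δ := by rw [hδ]; positivity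
  obtain ⟨m, hm⟩ := exists_nat_eq_of_coprime hcop hδnn ⟨r, hδM⟩ ⟨r', hδM'⟩
  have hm0 : 0 < m := by
    have : (0 : ℝ) < δ := by rw [hδ]; positivity
    rw [hm] at this
    exact_mod_cast this
  refine ⟨m, hm0, ?_⟩
  -- `HasAsympDegree`
  refine h₁.congr_left fun k => ?_
  rw [hm]

end CartierDivisor

end Literature.AlgebraicGeometry.Motives

end
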